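import Literature.NumberTheory.LFunctions.MertensCertificate

/-!
# Certified Odlyzko–te Riele computation: the zero count at height 2516 and the final sums

Compiled evaluations (`native_decide`) of `Literature.NumberTheory.LFunctions.ZetaNumerics.Mertens.checkTop` (the winding
certificate `topPieces` for `ζ(x + 2516 i)`, `½ ≤ x ≤ 2`, by 218 certified box evaluations of `ζ`,
and the Stirling inequality giving `N(2516) = 2000`, `zetaZeroCount_of_checkTop`) and of
`checkFinal` (`Σ L_k > 1.06 · 2^60`, `Σ U_k < -1.009 · 2^60`). The only non-standard axioms of this
file are the `native_decide` auxiliary axioms (trust in the Lean compiler), declared to the gate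
as `computational`.
-/

namespace Literature.NumberTheory.LFunctions.MertensCertificate.ZetaNumerics.Mertens

/-- The top-edge certificate passes: `checkTop = true` (hence `N(2516) = 2000`). [cite: OdlyzkoTeRiele1985, §4.1 p. 150 (T = γ₂₀₀₀; here T₀ = 2516 ∈ (γ₂₀₀₀, γ₂₀₀₁))] -/
theorem checkTop_holds : ZetaNumerics.Mertens.checkTop = true := by
  native_decide

/-- The final comparison passes: `checkFinal = true`. [cite: OdlyzkoTeRiele1985, §4.3 Table 3 (lines 15, 21) p. 155] -/
theorem checkFinal_holds : ZetaNumerics.Mertens.checkFinal = true := by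
  native_decide

end Literature.NumberTheory.LFunctions.MertensCertificate.ZetaNumerics.Mertens
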